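import Summits.CriticalPhenomena.PercolationContinuityZ3.Theorems.SahiBoxTP2WeakLimits
import Summits.CriticalPhenomena.PercolationContinuityZ3.Theorems.SahiBoxTP2HilbertFinsetMarginals
import Summits.CriticalPhenomena.PercolationContinuityZ3.Theorems.SahiBoxTP2RealSequences

/-!
# Box-TP₂ is closed under weak convergence: the Hilbert cube `[0,1]^ℕ` and `ℝ^ℕ`

Support file of the Sahi cell (`prim-sahi`, typer seat, generation 14; `--supports stmt-CriticalPhenomena-4575`).
Theorems only (no definitions, no named facts, no sorries).  Companion of `SahiBoxTP2WeakLimits.lean` (the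
abstract portmanteau theorem and the finite-dimensional instances `Q_d`, `ℝ^d`).

In infinite dimension the weak closure is obtained from the finite-dimensional one through the marginal
criteria of generations 12/13 (`isBoxTP2_iff_forall_map_finRestrict_unitInterval`: a finite measure on `[0,1]^ℕ` is
box-TP₂ iff all its initial-segment marginals are; `isBoxTP2_iff_forall_map_finRestrict_real`: the same on
`ℝ^ℕ`, by tightness) and the continuous mapping theorem (`FiniteMeasure.tendsto_map_of_tendsto_of_continuous`):

* `isBoxTP2_of_tendsto_finiteMeasure_hilbert` / `…_probabilityMeasure_hilbert` — on `ℕ → [0,1]`;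
* `isBoxTP2_of_tendsto_finiteMeasure_hilbert_countable` / `…_probabilityMeasure_hilbert_countable` — on
  `ι → [0,1]` for any countable `ι ≃ ℕ` (relabelling, `isBoxTP2_map_reindex_symm_iff`);
* `isBoxTP2_of_tendsto_finiteMeasure_realSeq` / `…_probabilityMeasure_realSeq` — on `ℕ → ℝ`;
* `isBoxTP2_of_tendsto_finiteMeasure_realSeq_countable` / `…_probabilityMeasure_realSeq_countable` — on
  `ι → ℝ`, `ι ≃ ℕ` (e.g. lattice fields on `ℤ^d`: every weak limit of box-TP₂ laws — finite-volume
  ferromagnetic lattice-field / `φ⁴` measures tensored with a product law outside the volume, Gaussians with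
  `M`-matrix precisions — is box-TP₂, hence FKG for all bounded measurable monotone functionals
  (`integral_mul_integral_le_of_isBoxTP2_realSeq`) and, given `C_n`, Sahi-positive of order `n`
  (`msahiE_nonneg_of_isBoxTP2_realSeq_of_sahiConjecture`)).

With `sahiConjecture_iff_forall_isBoxTP2_hilbert` (generation 12) this says: the class of laws on the Hilbert
cube whose Sahi positivity of every order is EQUIVALENT to Sahi's conjectures is weakly closed.

No sorries, no new axioms.
-/

noncomputable section

namespace Summit.CriticalPhenomena.PercolationContinuityZ3.Theorems.SahiBoxTP2

open MeasureTheory Set Filter Topology Function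
open scoped ENNReal unitInterval

variable {ι κ : Type*} {L : Filter κ} [NeBot L]

/-- The initial-segment restriction `(ℕ → X) → (Fin d → X)` is continuous (local copy of
`SahiBoxTP2HilbertAffiliation.continuous_finRestrict`, to keep the imports light). [folklore] -/
private theorem continuous_finRestrict' {X : Type*} [TopologicalSpace X] (d : ℕ) :
    Continuous (finRestrict (X := X) d) :=
  continuous_pi fun _ => continuous_apply _

/-- The coordinate relabelling `(ι → X) → (ℕ → X)` along `e : ι ≃ ℕ` is continuous. [folklore] -/
theorem continuous_reindex_symm {X : Type*} [TopologicalSpace X] [Preorder X] (e : ι ≃ ℕ) :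
    Continuous ((reindex (X := X) e).symm : (ι → X) → ℕ → X) :=
  continuous_pi fun k => by simpa only [reindex_symm_apply] using continuous_apply (e.symm k)

/-! ### The Hilbert cube `[0,1]^ℕ` -/

section Hilbert

/-- **Box-TP₂ is closed under weak convergence of finite measures on the Hilbert cube `[0,1]^ℕ`.**
[this work] -/
theorem isBoxTP2_of_tendsto_finiteMeasure_hilbert {μs : κ → FiniteMeasure (ℕ → I)}
    {μ : FiniteMeasure (ℕ → I)} (hconv : Tendsto μs L (𝓝 μ))
    (hbox : ∀ᶠ k in L, IsBoxTP2 (μs k : Measure (ℕ → I))) : IsBoxTP2 (μ : Measure (ℕ → I)) := by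
  rw [isBoxTP2_iff_forall_map_finRestrict_unitInterval]
  intro d
  have hmap := FiniteMeasure.tendsto_map_of_tendsto_of_continuous μs μ hconv
    (continuous_finRestrict' (X := I) d)
  have key := isBoxTP2_of_tendsto_finiteMeasure_cube hmap (hbox.mono fun k hk => by
    rw [FiniteMeasure.toMeasure_map]; exact hk.map_finRestrict_unitInterval d)
  rwa [FiniteMeasure.toMeasure_map] at key

/-- **Box-TP₂ is closed under weak convergence of probability measures on the Hilbert cube `[0,1]^ℕ`.**
[this work] -/
theorem isBoxTP2_of_tendsto_probabilityMeasure_hilbert {μs : κ → ProbabilityMeasure (ℕ → I)}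
    {μ : ProbabilityMeasure (ℕ → I)} (hconv : Tendsto μs L (𝓝 μ))
    (hbox : ∀ᶠ k in L, IsBoxTP2 (μs k : Measure (ℕ → I))) : IsBoxTP2 (μ : Measure (ℕ → I)) :=
  isBoxTP2_of_tendsto_finiteMeasure_hilbert
    ((ProbabilityMeasure.tendsto_nhds_iff_toFiniteMeasure_tendsto_nhds L).mp hconv)
    (hbox.mono fun i h => by
      simpa only [Function.comp_apply, ProbabilityMeasure.toMeasure_comp_toFiniteMeasure_eq_toMeasure]
        using h)

/-- **Box-TP₂ is closed under weak convergence of finite measures on `ι → [0,1]`, `ι` countably infinite.**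
[this work] -/
theorem isBoxTP2_of_tendsto_finiteMeasure_hilbert_countable [Countable ι] (e : ι ≃ ℕ) {μs : κ → FiniteMeasure (ι → I)}
    {μ : FiniteMeasure (ι → I)} (hconv : Tendsto μs L (𝓝 μ))
    (hbox : ∀ᶠ k in L, IsBoxTP2 (μs k : Measure (ι → I))) : IsBoxTP2 (μ : Measure (ι → I)) := by
  rw [← isBoxTP2_map_reindex_symm_iff e]
  have hmap := FiniteMeasure.tendsto_map_of_tendsto_of_continuous μs μ hconv
    (continuous_reindex_symm (X := I) e)
  have key := isBoxTP2_of_tendsto_finiteMeasure_hilbert hmap (hbox.mono fun k hk => by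
    rw [FiniteMeasure.toMeasure_map]; exact (isBoxTP2_map_reindex_symm_iff e _).2 hk)
  rwa [FiniteMeasure.toMeasure_map] at key

/-- **Box-TP₂ is closed under weak convergence of probability measures on `ι → [0,1]`, `ι` countably
infinite.** [this work] -/
theorem isBoxTP2_of_tendsto_probabilityMeasure_hilbert_countable [Countable ι] (e : ι ≃ ℕ)
    {μs : κ → ProbabilityMeasure (ι → I)} {μ : ProbabilityMeasure (ι → I)} (hconv : Tendsto μs L (𝓝 μ))
    (hbox : ∀ᶠ k in L, IsBoxTP2 (μs k : Measure (ι → I))) : IsBoxTP2 (μ : Measure (ι → I)) :=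
  isBoxTP2_of_tendsto_finiteMeasure_hilbert_countable e
    ((ProbabilityMeasure.tendsto_nhds_iff_toFiniteMeasure_tendsto_nhds L).mp hconv)
    (hbox.mono fun i h => by
      simpa only [Function.comp_apply, ProbabilityMeasure.toMeasure_comp_toFiniteMeasure_eq_toMeasure]
        using h)

end Hilbert

/-! ### Real sequences `ℝ^ℕ` and lattice fields `ι → ℝ` -/

section RealSeq

/-- **Box-TP₂ is closed under weak convergence of finite measures on `ℝ^ℕ`.** [this work] -/
theorem isBoxTP2_of_tendsto_finiteMeasure_realSeq {μs : κ → FiniteMeasure (ℕ → ℝ)}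
    {μ : FiniteMeasure (ℕ → ℝ)} (hconv : Tendsto μs L (𝓝 μ))
    (hbox : ∀ᶠ k in L, IsBoxTP2 (μs k : Measure (ℕ → ℝ))) : IsBoxTP2 (μ : Measure (ℕ → ℝ)) := by
  rw [isBoxTP2_iff_forall_map_finRestrict_real]
  intro d
  have hmap := FiniteMeasure.tendsto_map_of_tendsto_of_continuous μs μ hconv
    (continuous_finRestrict' (X := ℝ) d)
  have key := isBoxTP2_of_tendsto_finiteMeasure_real hmap (hbox.mono fun k hk => by
    rw [FiniteMeasure.toMeasure_map]; exact hk.map_finRestrict_real d)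
  rwa [FiniteMeasure.toMeasure_map] at key

/-- **Box-TP₂ is closed under weak convergence of probability measures on `ℝ^ℕ`.** [this work] -/
theorem isBoxTP2_of_tendsto_probabilityMeasure_realSeq {μs : κ → ProbabilityMeasure (ℕ → ℝ)}
    {μ : ProbabilityMeasure (ℕ → ℝ)} (hconv : Tendsto μs L (𝓝 μ))
    (hbox : ∀ᶠ k in L, IsBoxTP2 (μs k : Measure (ℕ → ℝ))) : IsBoxTP2 (μ : Measure (ℕ → ℝ)) :=
  isBoxTP2_of_tendsto_finiteMeasure_realSeq
    ((ProbabilityMeasure.tendsto_nhds_iff_toFiniteMeasure_tendsto_nhds L).mp hconv)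
    (hbox.mono fun i h => by
      simpa only [Function.comp_apply, ProbabilityMeasure.toMeasure_comp_toFiniteMeasure_eq_toMeasure]
        using h)

/-- **Box-TP₂ is closed under weak convergence of finite measures on `ι → ℝ`, `ι` countably infinite**
(lattice fields on `ℤ^d`). [this work] -/
theorem isBoxTP2_of_tendsto_finiteMeasure_realSeq_countable [Countable ι] (e : ι ≃ ℕ) {μs : κ → FiniteMeasure (ι → ℝ)}
    {μ : FiniteMeasure (ι → ℝ)} (hconv : Tendsto μs L (𝓝 μ))
    (hbox : ∀ᶠ k in L, IsBoxTP2 (μs k : Measure (ι → ℝ))) : IsBoxTP2 (μ : Measure (ι → ℝ)) := by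
  rw [← isBoxTP2_map_reindex_symm_iff e]
  have hmap := FiniteMeasure.tendsto_map_of_tendsto_of_continuous μs μ hconv
    (continuous_reindex_symm (X := ℝ) e)
  have key := isBoxTP2_of_tendsto_finiteMeasure_realSeq hmap (hbox.mono fun k hk => by
    rw [FiniteMeasure.toMeasure_map]; exact (isBoxTP2_map_reindex_symm_iff e _).2 hk)
  rwa [FiniteMeasure.toMeasure_map] at key

/-- **Box-TP₂ is closed under weak convergence of probability measures on `ι → ℝ`, `ι` countably infinite.**
[this work] -/
theorem isBoxTP2_of_tendsto_probabilityMeasure_realSeq_countable [Countable ι] (e : ι ≃ ℕ)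
    {μs : κ → ProbabilityMeasure (ι → ℝ)} {μ : ProbabilityMeasure (ι → ℝ)} (hconv : Tendsto μs L (𝓝 μ))
    (hbox : ∀ᶠ k in L, IsBoxTP2 (μs k : Measure (ι → ℝ))) : IsBoxTP2 (μ : Measure (ι → ℝ)) :=
  isBoxTP2_of_tendsto_finiteMeasure_realSeq_countable e
    ((ProbabilityMeasure.tendsto_nhds_iff_toFiniteMeasure_tendsto_nhds L).mp hconv)
    (hbox.mono fun i h => by
      simpa only [Function.comp_apply, ProbabilityMeasure.toMeasure_comp_toFiniteMeasure_eq_toMeasure]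
        using h)

end RealSeq

/-! ### Consequences for weak limits (FKG and Sahi positivity of the limit) -/

section Consequences

open Literature.Combinatorics.Sahi2008

/-- **FKG for weak limits on the Hilbert cube**: a weak limit of box-TP₂ probability measures on `[0,1]^ℕ`
satisfies `(∫ f)(∫ g) ≤ ∫ f g` for all nonnegative measurable monotone `f, g`. [this work] -/
theorem integral_mul_integral_le_of_tendsto_hilbert {μs : κ → ProbabilityMeasure (ℕ → I)}
    {μ : ProbabilityMeasure (ℕ → I)} (hconv : Tendsto μs L (𝓝 μ))
    (hbox : ∀ᶠ k in L, IsBoxTP2 (μs k : Measure (ℕ → I))) {f g : (ℕ → I) → ℝ}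
    (hfm : Measurable f) (hgm : Measurable g) (hf0 : ∀ u, 0 ≤ f u) (hg0 : ∀ u, 0 ≤ g u)
    (hf : Monotone f) (hg : Monotone g) :
    (∫ x, f x ∂(μ : Measure (ℕ → I))) * (∫ x, g x ∂(μ : Measure (ℕ → I))) ≤
      ∫ x, f x * g x ∂(μ : Measure (ℕ → I)) :=
  integral_mul_integral_le_of_isBoxTP2_hilbert (μ : Measure (ℕ → I))
    (isBoxTP2_of_tendsto_probabilityMeasure_hilbert hconv hbox) hfm hgm hf0 hg0 hf hg

/-- **Sahi positivity of weak limits on the Hilbert cube, given `C_n`.** [this work; conditional on Sahi's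
conjecture `C_n`] -/
theorem msahiE_nonneg_of_tendsto_hilbert_of_sahiConjecture {n : ℕ} (hC : SahiConjecture n)
    {μs : κ → ProbabilityMeasure (ℕ → I)} {μ : ProbabilityMeasure (ℕ → I)} (hconv : Tendsto μs L (𝓝 μ))
    (hbox : ∀ᶠ k in L, IsBoxTP2 (μs k : Measure (ℕ → I))) (f : Fin n → (ℕ → I) → ℝ)
    (hfm : ∀ i, Measurable (f i)) (hf0 : ∀ i u, 0 ≤ f i u) (hmono : ∀ i, Monotone (f i)) :
    0 ≤ msahiE (μ : Measure (ℕ → I)) n f :=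
  msahiE_nonneg_of_isBoxTP2_hilbert_of_sahiConjecture hC (μ : Measure (ℕ → I))
    (isBoxTP2_of_tendsto_probabilityMeasure_hilbert hconv hbox) f hfm hf0 hmono

end Consequences

end Summit.CriticalPhenomena.PercolationContinuityZ3.Theorems.SahiBoxTP2
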